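import Summits.QuantumFields.YangMills.Theorems.BalabanUVNodesN21SelectedTopCut13CoPHDefs
import Summits.QuantumFields.YangMills.Theorems.BalabanUVNodesN21ShellSplitSelected13CoPHDefs
import Summits.QuantumFields.YangMills.Theorems.BalabanUVNodesSpineReadingOfRecord13CoPHV

/-!
# N21 (NE7c) · THE TOP-LETTERED SPINE READING `crTop₁₃VAt K₀ jcut ρ n : SpineReading₁₃CoPH N` — definition lane: dag-n20-d's spine reading of record with the physical
# volume letter (`crOfRecord₁₃VAt`, the V edition of p587226) MIRRORED field for field, EXCEPT that the two runs' class weights are the fibre sums of the TOP-LETTERED terms at the top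
# letter SELECTED per `(K, t)` (argmin depth of the two-run top badness along the grid `ε_top(1 − ρ_K)^i`, `i ≤ n_K`) and the shell parts are the fibre sums of the
# top-lettered BANDS right below that letter — the reading on which `KeyedShellWeight` is a THEOREM with NO anti-concentration (companion `…TopLetteredReading13CoPH`)

R134 seat `pub-ymgap-dag-n21-d` (g10), node N21 = NE7c, strategy s2; lane K3⁷ `SpineGivenEndpointR13SepCoPH` (stmt-QuantumFields-20544, `--supports … --as helper`;
COUNT-NEUTRAL).  DEFINITION LANE; NO estimate.  Declared in THIS seat's namespace per dag-n20-d g28 ■ (cell bus l.28767: «to the consumers, declare in your namespaces»);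
dag-n21-e g21's OFFER-S3 spec (l.28788) adopted.  Imports T1 `…N21SelectedTopCut13CoPHDefs` (`topClassWeightAt`, `topBandWeightAt`), S1 `…N21ShellSplitSelected13CoPHDefs`
(`cutGrid`, `WidthLetter₁₃CoPH`, `DepthLetter₁₃CoPH`) and n20-d's `…SpineReadingOfRecord13CoPHV` (`runA₁₃ ∕ runB₁₃ ∕ histA₁₃ ∕ histB₁₃ ∕ keyA₁₃ ∕ keyB₁₃ ∕ classSet₁₃ ∕
badClass₁₃`, the canonical `wInf ∕ wshInf ∕ deltaCan` through it) — all BY NAME, nothing re-declared.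

WHAT IS DEFINED.
* §22 `topTermAtLevel ∕ topBandAtLevel` — the top-lettered term ∕ band of a history, LEVEL-POLYMORPHIC by `| 0 | k+1`: at level `0` the record's term and NO band (`χ_0 ≡ 1`:
  a run with no step has no top cut), at level `k+1` T1's `topClassWeightAt ∕ topBandWeightAt` (this is what lets run A's top `K₀ + K` be read against `keyA₁₃` with no
  level arithmetic).
* §23 at the `CoPH`-keyed Stage-13 record: `topBandSumA₁₃ ∕ topBandSumB₁₃` (a run's total top-lettered band mass at depth `i`), `topBadness₁₃` (both, normalised by the runs'
  dressed partition functions `schemeZ`), ★ `selTopDepth₁₃ … ρ n K t` (argmin over `range (n+1)`; spec ∕ `_le`), `topWeightA₁₃ ∕ topWeightB₁₃` (fibre sums along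
  `keyA₁₃ ∕ keyB₁₃` of the top-lettered terms at the selected letter), `topShellA₁₃ ∕ topShellB₁₃` (fibre sums of the top-lettered bands right below it),
  ★★ `crTop₁₃VAt K₀ jcut ρ n` (`ι ∕ dec ∕ l₀ := 1 ∕ vol := F.side ^ 4 ∕ K₀ ∕ T := classSet₁₃ ∕ Bad := badClass₁₃ … jcut` and the canonical weights ∕ rate EXACTLY as
  `crOfRecord₁₃VAt`; `A ∕ B ∕ shA ∕ shB` the top-lettered carriers), `crTop₁₃V := crTop₁₃VAt 0`, and the `rfl` dictionary.
* §22b (v1.1, APPEND-ONLY) `topLoweredAtLevel` (the top-lettered term with its FRONT FACTOR LOWERED, level-polymorphic) and the keyed cores `topCoreA₁₃ ∕ topCoreB₁₃` —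
  N19′'s CORE at this reading as a DEFINITE object (`= topWeight − topShell` on the live line, companion).

HONEST FRAMING (binding).  A reading DEFINITION + dictionary; NO estimate; nothing of Bałaban's asserted.  WHAT IT IS: the two runs' (2.18) expansions with the TOP STEP
re-lettered at a letter selected per `(K, t)` ([LF-I] p.181: the printed threshold ladders are not sharp numbers); its `KeyedExtraction` and `KeyedShellWeight` faces are
the companion's THEOREMS ((M1)-FREE).  WHAT IT IS NOT: print's fixed-threshold reading (`crOfRecord₁₃VAt`, where (M1) stands); the N20 face and N19′'s core at it are NOT
claimed (transfers only; N19′ must cut its core at the selected letter); the top 𝐑-step is omitted in the top-lettered terms (integral-preserving); `jcut ∕ ρ ∕ n` are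
LETTERS; no `Provisos₁₃CoPH` inhabitant claimed (K0⁷ open); NE7c NOT PRINTED ∕ NOT proved at print's thresholds; N21 NOT discharged; K3⁷ NOT claimed; counts UNMOVED (typed
28∕28 · discharged 5∕27); never a count claim.  No `sorry`, no `axiom`, no `instance`, no `notation`.  One finite four-torus programme at fixed `ε` — NOT ℝ⁴, NOT OS, NOT a
mass gap, NOT the Clay problem.
-/

noncomputable section

open scoped BigOperators
open Finset MeasureTheory

namespace Summit.QuantumFields.YangMills.Theorems.N21ShellSplitOfRecord13CoPH

open Literature.MathematicalPhysics.QuantumFieldTheory.Balaban1983to89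
open Literature.MathematicalPhysics.QuantumFieldTheory.Balaban1983to89.T4Continuum
open Literature.MathematicalPhysics.QuantumFieldTheory.Balaban1983to89.Node00
open YMDAG.UVSplit (SpineReading₁₃CoPH ShellSplit₁₃CoPH keyA₁₃ keyB₁₃ runA₁₃ runB₁₃ histA₁₃ histB₁₃ classSet₁₃ badClass₁₃)
open Summit.QuantumFields.BalabanUV.T4Continuum.Spine
open Summit.QuantumFields.YangMills.BalabanUVNodes.SpineCanonicalWeights

/-! ## §22 The top-lettered term and band of a history, level-polymorphic -/

section Level

variable (F : T4Family) (N : ℕ) [NeZero N] (ϑ : Stage9Params F N) (D : FiniteEpsData F (SU N)) (g₀ : ℕ → ℝ) (os : List (ULoop F))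
  (p : B12.RunParams) (g : ℕ → ℝ)

/-- **THE TOP-LETTERED TERM OF A HISTORY AT ITS OWN LEVEL** (top letter `θ`, source `t`): at level `0` the record's class weight (no step, no cut: `χ_0 ≡ 1`), at level
`k + 1` T1's `topClassWeightAt … k θ t`. [bookkeeping] -/
def topTermAtLevel (θ t : ℝ) : (j : ℕ) → SeqOfRecord F ϑ.ν ϑ.τ9.M g p.K j → ℝ
  | 0 => fun s => classWeightOfDatum₉ F N ϑ D g₀ os p g 0 t s
  | k + 1 => fun s' => topClassWeightAt F N ϑ D g₀ os p g k θ t s'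

/-- **THE TOP-LETTERED BAND OF A HISTORY AT ITS OWN LEVEL** between the letters `θ′ ≤ θ`: `0` at level `0`, T1's `topBandWeightAt … k θ θ′ t` at level `k + 1`. [bookkeeping] -/
def topBandAtLevel (θ θ' t : ℝ) : (j : ℕ) → SeqOfRecord F ϑ.ν ϑ.τ9.M g p.K j → ℝ
  | 0 => fun _ => 0
  | k + 1 => fun s' => topBandWeightAt F N ϑ D g₀ os p g k θ θ' t s'

/-- Face at level `0`. [bookkeeping] -/
@[simp] theorem topTermAtLevel_zero (θ t : ℝ) (s : SeqOfRecord F ϑ.ν ϑ.τ9.M g p.K 0) :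
    topTermAtLevel F N ϑ D g₀ os p g θ t 0 s = classWeightOfDatum₉ F N ϑ D g₀ os p g 0 t s := rfl

/-- Face at a successor level. [bookkeeping] -/
@[simp] theorem topTermAtLevel_succ (θ t : ℝ) (k : ℕ) (s' : SeqOfRecord F ϑ.ν ϑ.τ9.M g p.K (k + 1)) :
    topTermAtLevel F N ϑ D g₀ os p g θ t (k + 1) s' = topClassWeightAt F N ϑ D g₀ os p g k θ t s' := rfl

/-- Face at level `0`. [bookkeeping] -/
@[simp] theorem topBandAtLevel_zero (θ θ' t : ℝ) (s : SeqOfRecord F ϑ.ν ϑ.τ9.M g p.K 0) : topBandAtLevel F N ϑ D g₀ os p g θ θ' t 0 s = 0 := rfl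

/-- Face at a successor level. [bookkeeping] -/
@[simp] theorem topBandAtLevel_succ (θ θ' t : ℝ) (k : ℕ) (s' : SeqOfRecord F ϑ.ν ϑ.τ9.M g p.K (k + 1)) :
    topBandAtLevel F N ϑ D g₀ os p g θ θ' t (k + 1) s' = topBandWeightAt F N ϑ D g₀ os p g k θ θ' t s' := rfl

end Level

/-! ## §23 At the `CoPH`-keyed Stage-13 record: band masses, badness, the selected top depth, the top-lettered carriers, the reading -/

section Reading

variable {F : T4Family} {N : ℕ} [NeZero N]

/-- **RUN A's TOTAL TOP-LETTERED BAND MASS AT DEPTH `i`** (comparison `K`, top `K₀ + K`, width `ρ K`, source `t`). [bookkeeping] -/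
def topBandSumA₁₃ (θ : Stage13HParams F N) (hP : θ.Provisos₁₃CoPH F N) (K₀ : ℕ) (g₀ : ℕ → ℝ) (os : List (ULoop F)) (ρ : ℕ → ℝ) (K i : ℕ) (t : ℝ) : ℝ :=
  ∑ s : SeqOfRecord F θ.ν θ.τ9.M (histA₁₃ θ K₀ g₀ K) (K₀ + K) (K₀ + K),
    topBandAtLevel F N θ.toStage9Params (datumOfRecord₁₃CoPH F N θ hP) g₀ os (runA₁₃ F K₀ g₀ K) (histA₁₃ θ K₀ g₀ K)
      (cutGrid θ.ν (histA₁₃ θ K₀ g₀ K) (K₀ + K) (ρ K) i) (cutGrid θ.ν (histA₁₃ θ K₀ g₀ K) (K₀ + K) (ρ K) (i + 1)) t (K₀ + K) s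

/-- **RUN B's TOTAL TOP-LETTERED BAND MASS AT DEPTH `i`** (top `K₀ + K + 1`). [bookkeeping] -/
def topBandSumB₁₃ (θ : Stage13HParams F N) (hP : θ.Provisos₁₃CoPH F N) (K₀ : ℕ) (g₀ : ℕ → ℝ) (os : List (ULoop F)) (ρ : ℕ → ℝ) (K i : ℕ) (t : ℝ) : ℝ :=
  ∑ s' : SeqOfRecord F θ.ν θ.τ9.M (histB₁₃ θ K₀ g₀ K) (K₀ + K + 1) (K₀ + K + 1),
    topBandAtLevel F N θ.toStage9Params (datumOfRecord₁₃CoPH F N θ hP) g₀ os (runB₁₃ F K₀ g₀ K) (histB₁₃ θ K₀ g₀ K)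
      (cutGrid θ.ν (histB₁₃ θ K₀ g₀ K) (K₀ + K + 1) (ρ K) i) (cutGrid θ.ν (histB₁₃ θ K₀ g₀ K) (K₀ + K + 1) (ρ K) (i + 1)) t (K₀ + K + 1) s'

/-- **THE TOP BADNESS OF A DEPTH**: the two runs' top-lettered band masses at depth `i`, each normalised by its run's dressed partition function `schemeZ` (a definite real,
independent of the letter; `x ∕ 0 = 0`). [bookkeeping] -/
def topBadness₁₃ (θ : Stage13HParams F N) (hP : θ.Provisos₁₃CoPH F N) (K₀ : ℕ) (g₀ : ℕ → ℝ) (os : List (ULoop F)) (ρ : ℕ → ℝ) (K : ℕ) (t : ℝ) (i : ℕ) : ℝ :=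
  topBandSumA₁₃ θ hP K₀ g₀ os ρ K i t / T4GenFunBounds.schemeZ ((datumOfRecord₁₃CoPH F N θ hP).scheme g₀) os (K₀ + K) t +
    topBandSumB₁₃ θ hP K₀ g₀ os ρ K i t / T4GenFunBounds.schemeZ ((datumOfRecord₁₃CoPH F N θ hP).scheme g₀) os (K₀ + K + 1) t

/-- ★ **THE SELECTED TOP DEPTH** `i⋆(K, t) ≤ n`: an argmin of the top badness over the depths `0, …, n`. [bookkeeping] -/
def selTopDepth₁₃ (θ : Stage13HParams F N) (hP : θ.Provisos₁₃CoPH F N) (K₀ : ℕ) (g₀ : ℕ → ℝ) (os : List (ULoop F)) (ρ : ℕ → ℝ) (n K : ℕ) (t : ℝ) : ℕ :=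
  Classical.choose ((Finset.range (n + 1)).exists_min_image (topBadness₁₃ θ hP K₀ g₀ os ρ K t) ⟨0, Finset.mem_range.2 (Nat.succ_pos n)⟩)

/-- Spec of the selected top depth. [bookkeeping] -/
theorem selTopDepth₁₃_spec (θ : Stage13HParams F N) (hP : θ.Provisos₁₃CoPH F N) (K₀ : ℕ) (g₀ : ℕ → ℝ) (os : List (ULoop F)) (ρ : ℕ → ℝ) (n K : ℕ) (t : ℝ) :
    selTopDepth₁₃ θ hP K₀ g₀ os ρ n K t ∈ Finset.range (n + 1) ∧
      ∀ j ∈ Finset.range (n + 1), topBadness₁₃ θ hP K₀ g₀ os ρ K t (selTopDepth₁₃ θ hP K₀ g₀ os ρ n K t) ≤ topBadness₁₃ θ hP K₀ g₀ os ρ K t j :=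
  Classical.choose_spec ((Finset.range (n + 1)).exists_min_image (topBadness₁₃ θ hP K₀ g₀ os ρ K t) ⟨0, Finset.mem_range.2 (Nat.succ_pos n)⟩)

/-- The selected top depth is at most `n`. [bookkeeping] -/
theorem selTopDepth₁₃_le (θ : Stage13HParams F N) (hP : θ.Provisos₁₃CoPH F N) (K₀ : ℕ) (g₀ : ℕ → ℝ) (os : List (ULoop F)) (ρ : ℕ → ℝ) (n K : ℕ) (t : ℝ) :
    selTopDepth₁₃ θ hP K₀ g₀ os ρ n K t ≤ n :=
  Nat.lt_succ_iff.1 (Finset.mem_range.1 (selTopDepth₁₃_spec θ hP K₀ g₀ os ρ n K t).1)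

/-- **RUN A's TOP-LETTERED CLASS WEIGHT** at a key (comparison `K`, source `t`): the fibre sum along `keyA₁₃` of the top-lettered terms at the selected letter
`θ⋆ = ε_{K₀+K}(1 − ρ_K)^{i⋆(K,t)}`. [bookkeeping] -/
def topWeightA₁₃ (θ : Stage13HParams F N) (hP : θ.Provisos₁₃CoPH F N) (K₀ : ℕ) (g₀ : ℕ → ℝ) (os : List (ULoop F)) (ρ : ℕ → ℝ) (n : ℕ → ℕ)
    (K : ℕ) (t : ℝ) (x : Σ K, SiteSeqKey F (K₀ + K)) : ℝ :=
  letI : ∀ Kc, DecidableEq (SiteSeqKey F Kc) := fun _ => Classical.decEq _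
  ∑ s ∈ univ.filter (fun s => keyA₁₃ θ K₀ g₀ K s = x),
    topTermAtLevel F N θ.toStage9Params (datumOfRecord₁₃CoPH F N θ hP) g₀ os (runA₁₃ F K₀ g₀ K) (histA₁₃ θ K₀ g₀ K)
      (cutGrid θ.ν (histA₁₃ θ K₀ g₀ K) (K₀ + K) (ρ K) (selTopDepth₁₃ θ hP K₀ g₀ os ρ (n K) K t)) t (K₀ + K) s

/-- **RUN B's TOP-LETTERED CLASS WEIGHT** at a key (top `K₀ + K + 1`, along `keyB₁₃`, the SAME depth `i⋆(K,t)`). [bookkeeping] -/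
def topWeightB₁₃ (θ : Stage13HParams F N) (hP : θ.Provisos₁₃CoPH F N) (K₀ : ℕ) (g₀ : ℕ → ℝ) (os : List (ULoop F)) (ρ : ℕ → ℝ) (n : ℕ → ℕ)
    (K : ℕ) (t : ℝ) (x : Σ K, SiteSeqKey F (K₀ + K)) : ℝ :=
  letI : ∀ Kc, DecidableEq (SiteSeqKey F Kc) := fun _ => Classical.decEq _
  ∑ s' ∈ univ.filter (fun s' => keyB₁₃ θ K₀ g₀ K s' = x),
    topTermAtLevel F N θ.toStage9Params (datumOfRecord₁₃CoPH F N θ hP) g₀ os (runB₁₃ F K₀ g₀ K) (histB₁₃ θ K₀ g₀ K)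
      (cutGrid θ.ν (histB₁₃ θ K₀ g₀ K) (K₀ + K + 1) (ρ K) (selTopDepth₁₃ θ hP K₀ g₀ os ρ (n K) K t)) t (K₀ + K + 1) s'

/-- **RUN A's TOP-LETTERED SHELL PART** at a key: the fibre sum of the top-lettered bands right below the selected letter (`θ′ = θ⋆(1 − ρ_K)`). [bookkeeping] -/
def topShellA₁₃ (θ : Stage13HParams F N) (hP : θ.Provisos₁₃CoPH F N) (K₀ : ℕ) (g₀ : ℕ → ℝ) (os : List (ULoop F)) (ρ : ℕ → ℝ) (n : ℕ → ℕ)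
    (K : ℕ) (t : ℝ) (x : Σ K, SiteSeqKey F (K₀ + K)) : ℝ :=
  letI : ∀ Kc, DecidableEq (SiteSeqKey F Kc) := fun _ => Classical.decEq _
  ∑ s ∈ univ.filter (fun s => keyA₁₃ θ K₀ g₀ K s = x),
    topBandAtLevel F N θ.toStage9Params (datumOfRecord₁₃CoPH F N θ hP) g₀ os (runA₁₃ F K₀ g₀ K) (histA₁₃ θ K₀ g₀ K)
      (cutGrid θ.ν (histA₁₃ θ K₀ g₀ K) (K₀ + K) (ρ K) (selTopDepth₁₃ θ hP K₀ g₀ os ρ (n K) K t))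
      (cutGrid θ.ν (histA₁₃ θ K₀ g₀ K) (K₀ + K) (ρ K) (selTopDepth₁₃ θ hP K₀ g₀ os ρ (n K) K t + 1)) t (K₀ + K) s

/-- **RUN B's TOP-LETTERED SHELL PART** at a key. [bookkeeping] -/
def topShellB₁₃ (θ : Stage13HParams F N) (hP : θ.Provisos₁₃CoPH F N) (K₀ : ℕ) (g₀ : ℕ → ℝ) (os : List (ULoop F)) (ρ : ℕ → ℝ) (n : ℕ → ℕ)
    (K : ℕ) (t : ℝ) (x : Σ K, SiteSeqKey F (K₀ + K)) : ℝ :=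
  letI : ∀ Kc, DecidableEq (SiteSeqKey F Kc) := fun _ => Classical.decEq _
  ∑ s' ∈ univ.filter (fun s' => keyB₁₃ θ K₀ g₀ K s' = x),
    topBandAtLevel F N θ.toStage9Params (datumOfRecord₁₃CoPH F N θ hP) g₀ os (runB₁₃ F K₀ g₀ K) (histB₁₃ θ K₀ g₀ K)
      (cutGrid θ.ν (histB₁₃ θ K₀ g₀ K) (K₀ + K + 1) (ρ K) (selTopDepth₁₃ θ hP K₀ g₀ os ρ (n K) K t))
      (cutGrid θ.ν (histB₁₃ θ K₀ g₀ K) (K₀ + K + 1) (ρ K) (selTopDepth₁₃ θ hP K₀ g₀ os ρ (n K) K t + 1)) t (K₀ + K + 1) s'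

variable (N) in
/-- ★★ **THE TOP-LETTERED SPINE READING AT OFFSET `K₀`** (persistence policy `jcut`, width letter `ρ`, depth letter `n`): dag-n20-d's `crOfRecord₁₃VAt` field for field —
index type, class set, bad class, `l₀ := 1`, `vol := F.side ^ 4`, canonical `W ∕ Wsh ∕ δ` — with the TOP-LETTERED carriers `topWeightA₁₃ ∕ topWeightB₁₃ ∕ topShellA₁₃ ∕
topShellB₁₃` in place of the record's class weights and the free shell split. [bookkeeping] -/
def crTop₁₃VAt (K₀ : ℕ) (jcut : ℕ → ℕ) (ρ : WidthLetter₁₃CoPH N) (n : DepthLetter₁₃CoPH N) : SpineReading₁₃CoPH N := fun F θ hP g₀ os =>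
  { ι := Σ K, SiteSeqKey F (K₀ + K)
    dec := Classical.decEq _
    l₀ := 1
    vol := F.side ^ 4
    K₀ := K₀
    T := classSet₁₃ θ K₀ g₀
    A := topWeightA₁₃ θ hP K₀ g₀ os (ρ F θ hP g₀ os) (n F θ hP g₀ os)
    B := topWeightB₁₃ θ hP K₀ g₀ os (ρ F θ hP g₀ os) (n F θ hP g₀ os)
    shA := topShellA₁₃ θ hP K₀ g₀ os (ρ F θ hP g₀ os) (n F θ hP g₀ os)
    shB := topShellB₁₃ θ hP K₀ g₀ os (ρ F θ hP g₀ os) (n F θ hP g₀ os)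
    Bad := badClass₁₃ θ K₀ g₀ jcut
    W := wInf 1 (classSet₁₃ θ K₀ g₀) (topWeightA₁₃ θ hP K₀ g₀ os (ρ F θ hP g₀ os) (n F θ hP g₀ os)) (topWeightB₁₃ θ hP K₀ g₀ os (ρ F θ hP g₀ os) (n F θ hP g₀ os))
      (badClass₁₃ θ K₀ g₀ jcut)
    Wsh := wshInf 1 (classSet₁₃ θ K₀ g₀) (topWeightA₁₃ θ hP K₀ g₀ os (ρ F θ hP g₀ os) (n F θ hP g₀ os)) (topWeightB₁₃ θ hP K₀ g₀ os (ρ F θ hP g₀ os) (n F θ hP g₀ os))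
      (topShellA₁₃ θ hP K₀ g₀ os (ρ F θ hP g₀ os) (n F θ hP g₀ os)) (topShellB₁₃ θ hP K₀ g₀ os (ρ F θ hP g₀ os) (n F θ hP g₀ os))
    δ := letI : DecidableEq (Σ K, SiteSeqKey F (K₀ + K)) := Classical.decEq _
      deltaCan 1 (F.side ^ 4) (classSet₁₃ θ K₀ g₀) (badClass₁₃ θ K₀ g₀ jcut)
        (fun K t x => topWeightA₁₃ θ hP K₀ g₀ os (ρ F θ hP g₀ os) (n F θ hP g₀ os) K t x - topShellA₁₃ θ hP K₀ g₀ os (ρ F θ hP g₀ os) (n F θ hP g₀ os) K t x)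
        (fun K t x => topWeightB₁₃ θ hP K₀ g₀ os (ρ F θ hP g₀ os) (n F θ hP g₀ os) K t x - topShellB₁₃ θ hP K₀ g₀ os (ρ F θ hP g₀ os) (n F θ hP g₀ os) K t x) }

variable (N) in
/-- ★★ **THE TOP-LETTERED SPINE READING** `crTop₁₃V := crTop₁₃VAt 0`. [bookkeeping] -/
def crTop₁₃V (jcut : ℕ → ℕ) (ρ : WidthLetter₁₃CoPH N) (n : DepthLetter₁₃CoPH N) : SpineReading₁₃CoPH N :=
  crTop₁₃VAt N 0 jcut ρ n

/-! ### The dictionary (all `rfl`) -/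

section Dictionary

variable (K₀ : ℕ) (jcut : ℕ → ℕ) (ρ : WidthLetter₁₃CoPH N) (n : DepthLetter₁₃CoPH N) (θ : Stage13HParams F N) (hP : θ.Provisos₁₃CoPH F N) (g₀ : ℕ → ℝ)
  (os : List (ULoop F))

/-- `ι`. [bookkeeping] -/
theorem crTop₁₃VAt_ι : (crTop₁₃VAt N K₀ jcut ρ n F θ hP g₀ os).ι = (Σ K, SiteSeqKey F (K₀ + K)) := rfl
/-- `l₀ = 1`. [bookkeeping] -/
@[simp] theorem crTop₁₃VAt_l₀ : (crTop₁₃VAt N K₀ jcut ρ n F θ hP g₀ os).l₀ = 1 := rfl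
/-- `vol = F.side ^ 4`. [bookkeeping] -/
theorem crTop₁₃VAt_vol : (crTop₁₃VAt N K₀ jcut ρ n F θ hP g₀ os).vol = F.side ^ 4 := rfl
/-- `K₀`. [bookkeeping] -/
@[simp] theorem crTop₁₃VAt_K₀ : (crTop₁₃VAt N K₀ jcut ρ n F θ hP g₀ os).K₀ = K₀ := rfl
/-- `T` = n20-d's keyed class set of record. [bookkeeping] -/
theorem crTop₁₃VAt_T : (crTop₁₃VAt N K₀ jcut ρ n F θ hP g₀ os).T = classSet₁₃ θ K₀ g₀ := rfl
/-- `A` = run A's top-lettered fibre sums. [bookkeeping] -/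
theorem crTop₁₃VAt_A : (crTop₁₃VAt N K₀ jcut ρ n F θ hP g₀ os).A = topWeightA₁₃ θ hP K₀ g₀ os (ρ F θ hP g₀ os) (n F θ hP g₀ os) := rfl
/-- `B` = run B's top-lettered fibre sums. [bookkeeping] -/
theorem crTop₁₃VAt_B : (crTop₁₃VAt N K₀ jcut ρ n F θ hP g₀ os).B = topWeightB₁₃ θ hP K₀ g₀ os (ρ F θ hP g₀ os) (n F θ hP g₀ os) := rfl
/-- `shA` = run A's top-lettered shell part. [bookkeeping] -/
theorem crTop₁₃VAt_shA : (crTop₁₃VAt N K₀ jcut ρ n F θ hP g₀ os).shA = topShellA₁₃ θ hP K₀ g₀ os (ρ F θ hP g₀ os) (n F θ hP g₀ os) := rfl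
/-- `shB` = run B's top-lettered shell part. [bookkeeping] -/
theorem crTop₁₃VAt_shB : (crTop₁₃VAt N K₀ jcut ρ n F θ hP g₀ os).shB = topShellB₁₃ θ hP K₀ g₀ os (ρ F θ hP g₀ os) (n F θ hP g₀ os) := rfl
/-- `Bad` = n20-d's persistence class of record. [bookkeeping] -/
theorem crTop₁₃VAt_Bad : (crTop₁₃VAt N K₀ jcut ρ n F θ hP g₀ os).Bad = badClass₁₃ θ K₀ g₀ jcut := rfl
/-- `W` = the canonical least relative weight of the bad class at the top-lettered carriers. [bookkeeping] -/
theorem crTop₁₃VAt_W : (crTop₁₃VAt N K₀ jcut ρ n F θ hP g₀ os).W =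
    wInf 1 (classSet₁₃ θ K₀ g₀) (topWeightA₁₃ θ hP K₀ g₀ os (ρ F θ hP g₀ os) (n F θ hP g₀ os)) (topWeightB₁₃ θ hP K₀ g₀ os (ρ F θ hP g₀ os) (n F θ hP g₀ os))
      (badClass₁₃ θ K₀ g₀ jcut) := rfl
/-- `Wsh` = the canonical relative shell weight at the top-lettered carriers. [bookkeeping] -/
theorem crTop₁₃VAt_Wsh : (crTop₁₃VAt N K₀ jcut ρ n F θ hP g₀ os).Wsh =
    wshInf 1 (classSet₁₃ θ K₀ g₀) (topWeightA₁₃ θ hP K₀ g₀ os (ρ F θ hP g₀ os) (n F θ hP g₀ os)) (topWeightB₁₃ θ hP K₀ g₀ os (ρ F θ hP g₀ os) (n F θ hP g₀ os))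
      (topShellA₁₃ θ hP K₀ g₀ os (ρ F θ hP g₀ os) (n F θ hP g₀ os)) (topShellB₁₃ θ hP K₀ g₀ os (ρ F θ hP g₀ os) (n F θ hP g₀ os)) := rfl
/-- The record object reads the offset-`0` form (`rfl`). [bookkeeping] -/
theorem crTop₁₃V_eq (jcut : ℕ → ℕ) (ρ : WidthLetter₁₃CoPH N) (n : DepthLetter₁₃CoPH N) : crTop₁₃V N jcut ρ n = crTop₁₃VAt N 0 jcut ρ n := rfl

end Dictionary

end Reading

/-! ## §22b (v1.1, APPEND-ONLY) The LOWERED top-lettered term of a history, level-polymorphic — N19′'s CORE at the top-lettered reading as a definite object -/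

section Lowered

variable (F : T4Family) (N : ℕ) [NeZero N] (ϑ : Stage9Params F N) (D : FiniteEpsData F (SU N)) (g₀ : ℕ → ℝ) (os : List (ULoop F))
  (p : B12.RunParams) (g : ℕ → ℝ)

/-- **THE LOWERED TOP-LETTERED TERM OF A HISTORY AT ITS OWN LEVEL** (top letter `θ`, lowered front letter `θ′`, source `t`): at level `0` the record's class weight (no cut),
at level `k + 1` the integral `∫ χ_{k+1}^{θ′}(s′)·topSlot^{θ}(s′)` — the top-lettered term with its FRONT FACTOR LOWERED to `θ′` and its last (3.2) weight kept at `θ`.  For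
`θ′ ≤ θ` this IS the core `topTermAtLevel θ − topBandAtLevel θ θ′` (companion, from T3 §20a `topClassWeight_sub_topBand_eq_lowered`): the object a consumer matching the two
runs' CORES at the selected letter reads (T4IndicatorShell design (i)). (v1.1) [bookkeeping] -/
def topLoweredAtLevel (θ θ' t : ℝ) : (j : ℕ) → SeqOfRecord F ϑ.ν ϑ.τ9.M g p.K j → ℝ
  | 0 => fun s => classWeightOfDatum₉ F N ϑ D g₀ os p g 0 t s
  | k + 1 => fun s' => ∫ V, chiSeqOfRecordAt F N ϑ.ν ϑ.τ9.M g p.K (k + 1) θ' s' V * topSlotAt F N ϑ D g₀ os p g k θ t s' V ∂fieldMeasure (F.P p.K) (k + 1) (SU N)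

/-- Face at level `0` (v1.1). [bookkeeping] -/
@[simp] theorem topLoweredAtLevel_zero (θ θ' t : ℝ) (s : SeqOfRecord F ϑ.ν ϑ.τ9.M g p.K 0) :
    topLoweredAtLevel F N ϑ D g₀ os p g θ θ' t 0 s = classWeightOfDatum₉ F N ϑ D g₀ os p g 0 t s := rfl

/-- Face at a successor level (v1.1). [bookkeeping] -/
@[simp] theorem topLoweredAtLevel_succ (θ θ' t : ℝ) (k : ℕ) (s' : SeqOfRecord F ϑ.ν ϑ.τ9.M g p.K (k + 1)) :
    topLoweredAtLevel F N ϑ D g₀ os p g θ θ' t (k + 1) s' =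
      ∫ V, chiSeqOfRecordAt F N ϑ.ν ϑ.τ9.M g p.K (k + 1) θ' s' V * topSlotAt F N ϑ D g₀ os p g k θ t s' V ∂fieldMeasure (F.P p.K) (k + 1) (SU N) := rfl

end Lowered

section CoreReading

variable {F : T4Family} {N : ℕ} [NeZero N]

/-- **RUN A's TOP-LETTERED CORE at a key** (v1.1): the fibre sum along `keyA₁₃` of the LOWERED top-lettered terms at the selected letter `θ⋆` with front factor at
`θ⋆(1 − ρ_K)` — equals `topWeightA₁₃ − topShellA₁₃` on the live line (companion). [bookkeeping] -/
def topCoreA₁₃ (θ : Stage13HParams F N) (hP : θ.Provisos₁₃CoPH F N) (K₀ : ℕ) (g₀ : ℕ → ℝ) (os : List (ULoop F)) (ρ : ℕ → ℝ) (n : ℕ → ℕ)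
    (K : ℕ) (t : ℝ) (x : Σ K, SiteSeqKey F (K₀ + K)) : ℝ :=
  letI : ∀ Kc, DecidableEq (SiteSeqKey F Kc) := fun _ => Classical.decEq _
  ∑ s ∈ univ.filter (fun s => keyA₁₃ θ K₀ g₀ K s = x),
    topLoweredAtLevel F N θ.toStage9Params (datumOfRecord₁₃CoPH F N θ hP) g₀ os (runA₁₃ F K₀ g₀ K) (histA₁₃ θ K₀ g₀ K)
      (cutGrid θ.ν (histA₁₃ θ K₀ g₀ K) (K₀ + K) (ρ K) (selTopDepth₁₃ θ hP K₀ g₀ os ρ (n K) K t))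
      (cutGrid θ.ν (histA₁₃ θ K₀ g₀ K) (K₀ + K) (ρ K) (selTopDepth₁₃ θ hP K₀ g₀ os ρ (n K) K t + 1)) t (K₀ + K) s

/-- **RUN B's TOP-LETTERED CORE at a key** (v1.1). [bookkeeping] -/
def topCoreB₁₃ (θ : Stage13HParams F N) (hP : θ.Provisos₁₃CoPH F N) (K₀ : ℕ) (g₀ : ℕ → ℝ) (os : List (ULoop F)) (ρ : ℕ → ℝ) (n : ℕ → ℕ)
    (K : ℕ) (t : ℝ) (x : Σ K, SiteSeqKey F (K₀ + K)) : ℝ :=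
  letI : ∀ Kc, DecidableEq (SiteSeqKey F Kc) := fun _ => Classical.decEq _
  ∑ s' ∈ univ.filter (fun s' => keyB₁₃ θ K₀ g₀ K s' = x),
    topLoweredAtLevel F N θ.toStage9Params (datumOfRecord₁₃CoPH F N θ hP) g₀ os (runB₁₃ F K₀ g₀ K) (histB₁₃ θ K₀ g₀ K)
      (cutGrid θ.ν (histB₁₃ θ K₀ g₀ K) (K₀ + K + 1) (ρ K) (selTopDepth₁₃ θ hP K₀ g₀ os ρ (n K) K t))
      (cutGrid θ.ν (histB₁₃ θ K₀ g₀ K) (K₀ + K + 1) (ρ K) (selTopDepth₁₃ θ hP K₀ g₀ os ρ (n K) K t + 1)) t (K₀ + K + 1) s'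

end CoreReading

end Summit.QuantumFields.YangMills.Theorems.N21ShellSplitOfRecord13CoPH

end
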